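import Mathlib.Data.Finset.Card
import HarnessLib

/-!
# Counting along hub moves: an injection `W ∖ cW → cW ∖ W` along moves gives `#(F ∩ W) ≤ #(F ∩ cW)` (PATH LEMMA glue, layer 0)

Support file (`--supports stmt-CriticalPhenomena-4575`, closed), prover `prim-cplus-coupling` (gen 51).  No definitions, no notations,
no named facts, no sorries; standard axioms.  Memo `prim-cplus-coupling/A5-COUPLING-gen51.md` §2.6 (Corollary: path lemma from the perfect matching), §7(2).

The hub-Kleitman inequalities `#(F ∩ W) ≤ #(F ∩ cW)` (memo-50 §2) are all proved by the same bookkeeping: the common part `W ∩ cW` cancels, and an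
injection `Φ : W ∖ cW → cW ∖ W` with `Φ(ω)` a hub move of `ω` carries `F ∩ (W ∖ cW)` into `F ∩ (cW ∖ W)` because `F` is closed under moves.
`hub_card_filter_le_of_moveInjection` is this statement for an arbitrary finite family `F`, predicates `W`, `cW` and move relation `R`.
It is the form in which the augmented staircase theorem (`…KernelMixHubClosed.hubStair_matching_closed`, the injection) yields the PATH LEMMA, and
in which the explicit involutions of the gate types `(u,u)`, `(j,u)` (memo §1.5) yield theirs.
[cite: KozmaNitzan2024, Questions 8–9 (§5.5 p. 36) (context)]
-/

namespace Summit.CriticalPhenomena.PercolationContinuityZ3.Theorems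

open Finset

namespace Coefficientwise

/-- **Counting along moves.**  If `F` is closed under the move relation `R` and `Φ` maps `W ∖ cW` injectively into `cW ∖ W` along `R`, then
`#(F ∩ W) ≤ #(F ∩ cW)`. [folklore] -/
theorem hub_card_filter_le_of_moveInjection {γ : Type*} [DecidableEq γ] (F : Finset γ) (W cW : γ → Prop)
    [DecidablePred W] [DecidablePred cW] (R : γ → γ → Prop)
    (hF : ∀ ω ∈ F, ∀ ω', R ω ω' → ω' ∈ F) (Φ : γ → γ)
    (hΦ : ∀ ω, W ω → ¬ cW ω → cW (Φ ω) ∧ ¬ W (Φ ω) ∧ R ω (Φ ω))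
    (hΦinj : ∀ ω ω', W ω → ¬ cW ω → W ω' → ¬ cW ω' → Φ ω = Φ ω' → ω = ω') :
    (F.filter (fun ω => W ω)).card ≤ (F.filter (fun ω => cW ω)).card := by
  classical
  -- split F ∩ W into the common part and the sources
  have hsplit : F.filter (fun ω => W ω) =
      (F.filter (fun ω => W ω ∧ cW ω)) ∪ (F.filter (fun ω => W ω ∧ ¬ cW ω)) := by
    ext ω
    simp only [Finset.mem_union, Finset.mem_filter]
    constructor
    · rintro ⟨hωF, hW⟩
      by_cases hc : cW ω
      · exact Or.inl ⟨hωF, hW, hc⟩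
      · exact Or.inr ⟨hωF, hW, hc⟩
    · rintro (⟨hωF, hW, _⟩ | ⟨hωF, hW, _⟩) <;> exact ⟨hωF, hW⟩
  -- the sources inject into the targets inside F
  have himg : (F.filter (fun ω => W ω ∧ ¬ cW ω)).image Φ ⊆ F.filter (fun ω => cW ω ∧ ¬ W ω) := by
    intro x hx
    obtain ⟨ω, hω, rfl⟩ := Finset.mem_image.mp hx
    obtain ⟨hωF, hW, hc⟩ := Finset.mem_filter.mp hω
    obtain ⟨h1, h2, h3⟩ := hΦ ω hW hc
    exact Finset.mem_filter.mpr ⟨hF ω hωF _ h3, h1, h2⟩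
  have hinj : ((F.filter (fun ω => W ω ∧ ¬ cW ω)).image Φ).card = (F.filter (fun ω => W ω ∧ ¬ cW ω)).card := by
    apply Finset.card_image_of_injOn
    intro ω hω ω' hω' h
    obtain ⟨_, hW, hc⟩ := Finset.mem_filter.mp (Finset.mem_coe.mp hω)
    obtain ⟨_, hW', hc'⟩ := Finset.mem_filter.mp (Finset.mem_coe.mp hω')
    exact hΦinj ω ω' hW hc hW' hc' h
  -- the common part and the targets are disjoint parts of F ∩ cW
  have hsub : (F.filter (fun ω => W ω ∧ cW ω)) ∪ (F.filter (fun ω => W ω ∧ ¬ cW ω)).image Φ ⊆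
      F.filter (fun ω => cW ω) := by
    intro x hx
    rcases Finset.mem_union.mp hx with h | h
    · obtain ⟨hxF, _, hc⟩ := Finset.mem_filter.mp h
      exact Finset.mem_filter.mpr ⟨hxF, hc⟩
    · obtain ⟨hxF, hc, _⟩ := Finset.mem_filter.mp (himg h)
      exact Finset.mem_filter.mpr ⟨hxF, hc⟩
  have hdisj1 : Disjoint (F.filter (fun ω => W ω ∧ cW ω)) (F.filter (fun ω => W ω ∧ ¬ cW ω)) := by
    rw [Finset.disjoint_left]
    intro x h1 h2
    exact (Finset.mem_filter.mp h2).2.2 (Finset.mem_filter.mp h1).2.2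
  have hdisj2 : Disjoint (F.filter (fun ω => W ω ∧ cW ω)) ((F.filter (fun ω => W ω ∧ ¬ cW ω)).image Φ) := by
    rw [Finset.disjoint_left]
    intro x h1 h2
    exact (Finset.mem_filter.mp (himg h2)).2.2 (Finset.mem_filter.mp h1).2.1
  calc (F.filter (fun ω => W ω)).card
      = (F.filter (fun ω => W ω ∧ cW ω)).card + (F.filter (fun ω => W ω ∧ ¬ cW ω)).card := by
        rw [hsplit, Finset.card_union_of_disjoint hdisj1]
    _ = ((F.filter (fun ω => W ω ∧ cW ω)) ∪ (F.filter (fun ω => W ω ∧ ¬ cW ω)).image Φ).card := by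
        rw [Finset.card_union_of_disjoint hdisj2, hinj]
    _ ≤ (F.filter (fun ω => cW ω)).card := Finset.card_le_card hsub

end Coefficientwise

end Summit.CriticalPhenomena.PercolationContinuityZ3.Theorems
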